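import Mathlib
import Literature.Analysis.FunctionSpaces.PVTheory
import Literature.Analysis.FunctionSpaces.PVTrueUniversal
import Literature.Computability.Complexity.CNF
import HarnessLib

/-!
# BIRTH SKELETON of piece M = `KrajicekMEP` (Krajíček's Problem 3.2) — split of crux `Target` (stmt-PneNP-10709), route LatticeMagic

BC3 for the crux piece `KrajicekMEP` (prepared child of `Target`; line `Cruxes/Target/Lines/KrajicekSplit.lean`, stub `stub_MEP`).
§§1–3 repeat the vocabulary of the line file (self-contained copy; namespace `…KrajicekSplit.BirthMEP`). §4 = TWO NAMED STUBS and the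
kernel-checked composition `KrajicekMEP_of : MEP`, cut along Krajíček's own remarks (arXiv:2506.20221 §3):

* `stub_toBB` — **the open heart**: every model `M ⊨ T_PV` with an element `φ` having no proof in `M` in any proof system extends,
  `Σᵇ₁(PV)`-conservatively for properties of elements and WITHOUT ACQUIRING A PROOF OF `φ`, to a model of `T_PV + S¹₂(PV)`
  ("the caveat is that such extensions are known to exist for models satisfying the BB scheme for open formulas but it is not known in
  general"; every `M ⊨ T_PV = Th_∀(ℕ)` embeds into a model of `T_PV + S¹₂(PV)` — indeed of `Th(ℕ)` — by general model theory; the content is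
  keeping Condition 1, a universal property, and the `Σᵇ₁`-properties, on the way up);
* `stub_KP` — **Krajíček–Pudlák for models with `Σᵇ₁`-PIND** (Thm 3.1 "after [KP-model]" + the remark that `M'` can be arranged to
  introduce no new lengths; Krajíček–Pudlák, *Propositional provability in models of weak arithmetic*, CSL '89, LNCS 440; Krajíček 1995
  §9.4): a model of `T_PV + S¹₂(PV)` in which `φ` has no proof in any proof system has an extension `M' ⊨ T_PV + ¬φ ∈ SAT` with
  `Log(M') = Log(M)`. In print for countable models and, for the `Log` clause, under an additional hypothesis on `M` (the forcing
  construction) — "essentially known", stated here in the generality the composition needs.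

Then MEP with `M* :=` the model of `stub_toBB`: `Σᵇ₁`-preservation is the stub's clause, `Log(M*) = Log(M')` is `stub_KP`'s.
Sorries ONLY in the two stubs; `KrajicekMEP_of` is the line's `ModelExtensionProperty` verbatim (same text as route item `KrajicekMEP`
up to `let`-inlining, rfl).
-/

set_option linter.dupNamespace false

namespace Summit.PneNP.PneNP.Cruxes.Target.KrajicekSplit.BirthMEP

open FirstOrder FirstOrder.Language
open Literature.Analysis.FunctionSpaces Literature.Computability.Complexity
open Literature.Computability.MetaComplexity
open _root_.Computability

/-! ### 1. Numbers as strings, strings as formulas -/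

/-- The bit string named by the number `n`: the binary notation of `n + 1` (Mathlib `encodeNat`,
least significant bit first, so it ends in the leading bit `1`) with that final `1` removed. This is
the dyadic bijection `ℕ ≃ {0,1}*` (`0 ↦ ε, 1 ↦ 0, 2 ↦ 1, 3 ↦ 00, …`), of linear distortion
`|strOfNat n| = |n + 1| − 1`, hence harmless for polynomial time on binary notation (the convention of
`cobham_holds`). [folklore] -/
def strOfNat (n : ℕ) : List Bool :=
  (encodeNat (n + 1)).dropLast

/-- The number naming the bit string `w` (inverse of `strOfNat`): read `w` followed by a leading `1`
as a positive binary number and subtract one. [folklore] -/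
def natOfStr (w : List Bool) : ℕ :=
  decodeNat (w ++ [true]) - 1

/-- The propositional formula coded by the number `n`, with TOTAL decoding: if `strOfNat n` is not the
code of a formula (`encodingPropForm`, `CNF.lean`) the number names the falsum `⊥` — a non-tautology
falsified by every assignment, so that junk codes neither have proofs in sound systems nor obstruct
satisfiability of their negation. [folklore] -/
def flaOfNat (n : ℕ) : PropForm ℕ :=
  (encodingPropForm.decode (strOfNat n)).getD (PropForm.const false)

/-- The number coding the formula `φ`. [folklore] -/
def natOfFla (φ : PropForm ℕ) : ℕ :=
  natOfStr (encodingPropForm.encode φ)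

/-- **Falsification**, the polynomial-time function behind "`¬φ ∈ SAT`": `falsifiesFn a y = 1` iff the
string of `y`, read as a truth assignment (`i ↦ (strOfNat y)_i`, `false` beyond its length), gives the
formula coded by `a` the value `false`; otherwise `0`. (Polynomial time on binary notation: decode,
evaluate; hence the interpretation of some `PV` symbol by `cobham_holds` — not needed to STATE anything
below.) [folklore] -/
def falsifiesFn (a y : ℕ) : ℕ :=
  if (flaOfNat a).eval (fun i => (strOfNat y).getD i false) = false then 1 else 0

/-- A binary `PV` symbol `prf` is a **sound proof predicate** in the standard model: whenever
`prf(x, a) = 1` ("`x` is a proof of `a`"), the formula coded by `a` is a tautology. This is the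
relational form of "an arbitrary propositional proof system" (Cook–Reckhow function `P` ↦ the predicate
`[P(x) = a]`, a `PV` symbol by Cobham's theorem; predicate `R` ↦ the function
`⟨x, a⟩ ↦ if R(x, a) then a else ⌜⊤⌝`); completeness plays no role in "`φ` has a proof".
[cite: Krajicek2019, Def. 1.5.1] -/
def IsSoundProofSymbol (prf : PVFun 2) : Prop :=
  ∀ x a : ℕ, prf.eval ![x, a] = 1 → (flaOfNat a).IsTautology

/-! ### 2. Inside an `L(PV)`-structure -/

section Structures

variable (K : Type) [Language.pv.Structure K]

/-- The element `1 = s₁(0)` of an `L(PV)`-structure. [folklore] -/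
def pvOne : K :=
  papp (PVFun.bit true) ![papp PVFun.zero ![] ]

variable {K}

/-- The length `|x|` of an element of an `L(PV)`-structure (the symbol `len`). [folklore] -/
def pvLen (x : K) : K :=
  papp PVFun.len ![x]

/-- In the standard model, `pvOne ℕ = 1`. [folklore] -/
@[simp] theorem pvOne_nat : pvOne ℕ = 1 := by
  simp [pvOne, papp]

/-- In the standard model, `pvLen n = Nat.size n = |n|`. [folklore] -/
@[simp] theorem pvLen_nat (n : ℕ) : pvLen n = Nat.size n := by
  simp [pvLen, papp]

end Structures

/-- **Condition 1** of Krajíček's Thm 3.1 (after Krajíček–Pudlák, *Propositional provability in models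
of weak arithmetic*, CSL '89): the element `φ` (a propositional formula in the sense of the model `M`)
**has no proof in `M` in any proof system** — for every sound proof predicate `prf` (a standard proof
system; its proofs `x` range over ALL of `M`, of any non-standard length) `M ⊨ ∀ x, prf(x, φ) ≠ 1`.
[cite: Krajicek2025Squeeze, Thm. 3.1] -/
def NoProofInModel (M : Type) [Language.pv.Structure M] (φ : M) : Prop :=
  ∀ prf : PVFun 2, IsSoundProofSymbol prf → ∀ x : M, papp prf ![x, φ] ≠ pvOne M

/-! ### 3. MEP — Krajíček's Problem 3.2 -/

/-- **MEP, the model-extension property for `T_PV` = the affirmative answer to Krajíček's Problem 3.2**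
(arXiv:2506.20221, §3). For every model `M ⊨ T_PV` (`trueUnivPV`: all true universal `L(PV)`-sentences)
and every `φ ∈ M` that has no proof in `M` in any proof system (`NoProofInModel`, Condition 1 of Thm 3.1),
there are `L(PV)`-structures `M ⊆ M* ⊆ M'` (embeddings `e`, `f`) such that
* `M*` preserves from `M` all `Σᵇ₁(PV)`-properties of elements (`IsSigmabPV 1` formulas, any arity),
* `M' ⊨ T_PV + ¬φ ∈ SAT` (some `y ∈ M'` falsifies `φ`: `fal(φ, y) = 1`),
* `Log(M*) = Log(M')` (every length of `M'` is the length of an element of `M*`; `⊆` is automatic).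
Typed SCHEMATICALLY in the symbol `fal` computing `falsifiesFn` in `ℕ`: `T_PV` proves any two such
symbols equal, so the statement does not depend on the choice, and a symbol exists by Cobham's theorem
(`cobham_holds`). STATUS: OPEN ("it is open at present if it holds", loc. cit. abstract); known for models
of `S¹₂`/`BB` (Krajíček–Pudlák 1990, by the sharply bounded collection scheme) and, with the `Log`
clause, by the forcing of Krajíček 1995 §9.4 under an extra hypothesis on `M`; the NEGATIVE answer
implies `P ≠ NP` (loc. cit.: otherwise `T_PV ⊢ S¹₂(PV)`). By Thm 4.1, MEP ∧ (ST) ⟹ `NP ≠ coNP`.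
[cite: Krajicek2025Squeeze, Problem 3.2] -/
def ModelExtensionProperty : Prop :=
  ∀ fal : PVFun 2, (∀ a y : ℕ, fal.eval ![a, y] = falsifiesFn a y) →
    ∀ (M : Type) [Language.pv.Structure M] [M ⊨ trueUnivPV] (φ : M), NoProofInModel M φ →
      ∃ (Ms : Type) (_ : Language.pv.Structure Ms) (M' : Type) (_ : Language.pv.Structure M')
        (e : M ↪[Language.pv] Ms) (f : Ms ↪[Language.pv] M'),
        M' ⊨ trueUnivPV ∧
        (∀ (k : ℕ) (θ : Language.pv.Formula (Fin k)), IsSigmabPV 1 θ →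
          ∀ v : Fin k → M, θ.Realize v → θ.Realize (e ∘ v)) ∧
        (∃ y : M', papp fal ![f (e φ), y] = pvOne M') ∧
        (∀ y : M', ∃ x : Ms, pvLen (f x) = pvLen y)

/-! ### 4. The two stubs and the composition -/

/-- **STUB (open heart of MEP): up to sharply bounded collection.** Every `M ⊨ T_PV` with an element `φ`
that has no proof in `M` in any proof system has an `L(PV)`-extension `M ↪ M*` with `M* ⊨ T_PV + S¹₂(PV)`
that preserves every `Σᵇ₁(PV)`-property of elements of `M` and in which `φ` STILL has no proof in any proof
system. (Existence of SOME extension to a model of `T_PV + S¹₂(PV)`, even of `Th(ℕ)`, is automatic for a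
model of the true universal theory; the two preservation clauses are the content. Under `P = NP` it holds
with `M* = M`, since then `T_PV ⊢ S¹₂(PV)` — Krajíček's remark that ¬MEP ⟹ `P ≠ NP`.)
[cite: Krajicek2025Squeeze, §3 (discussion of Problem 3.2)] -/
theorem stub_toBB (M : Type) [Language.pv.Structure M] [M ⊨ trueUnivPV] (φ : M)
    (hφ : NoProofInModel M φ) :
    ∃ (Ms : Type) (_ : Language.pv.Structure Ms) (e : M ↪[Language.pv] Ms),
      Ms ⊨ trueUnivPV ∧ Ms ⊨ S2PV 1 ∧
      (∀ (k : ℕ) (θ : Language.pv.Formula (Fin k)), IsSigmabPV 1 θ →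
        ∀ v : Fin k → M, θ.Realize v → θ.Realize (e ∘ v)) ∧
      NoProofInModel Ms (e φ) := by
  sorry

/-- **STUB (Krajíček–Pudlák, models with `Σᵇ₁`-PIND): the satisfying extension with no new lengths.**
For a model `M ⊨ T_PV + S¹₂(PV)` and `φ ∈ M` with no proof in `M` in any proof system there is an
extension `M ↪ M' ⊨ T_PV` in which some assignment falsifies `φ` (`¬φ ∈ SAT`) and which introduces no new
lengths (`Log(M') = Log(M)`). Thm 3.1 of arXiv:2506.20221 (after Krajíček–Pudlák 1990, for models of `S¹₂`,
by compactness + "an inconsistency is a proof system") gives `M'`; the `Log` clause is the closing remark of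
[KP-model] / the forcing of Krajíček 1995 §9.4 (there under an extra hypothesis on `M`, and for countable
`M`) — stated here in the generality the composition uses. Schematic in the falsification symbol `fal`.
[cite: Krajicek2025Squeeze, Thm. 3.1] [cite: Krajicek1995, §9.4] -/
theorem stub_KP (fal : PVFun 2) (hfal : ∀ a y : ℕ, fal.eval ![a, y] = falsifiesFn a y)
    (M : Type) [Language.pv.Structure M] [M ⊨ trueUnivPV] [M ⊨ S2PV 1] (φ : M)
    (hφ : NoProofInModel M φ) :
    ∃ (M' : Type) (_ : Language.pv.Structure M') (f : M ↪[Language.pv] M'),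
      M' ⊨ trueUnivPV ∧ (∃ y : M', papp fal ![f φ, y] = pvOne M') ∧
      (∀ y : M', ∃ x : M, pvLen (f x) = pvLen y) := by
  sorry

/-- **The composition: the two stubs give MEP** (`ModelExtensionProperty`, = route item `KrajicekMEP`):
`M* :=` the model of `stub_toBB`, `M' :=` the model of `stub_KP` over `M*`. -/
theorem KrajicekMEP_of : ModelExtensionProperty := by
  intro fal hfal M _ _ φ hφ
  obtain ⟨Ms, instMs, e, hT, hS, hpres, hφ'⟩ := stub_toBB M φ hφ
  haveI : Ms ⊨ trueUnivPV := hT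
  haveI : Ms ⊨ S2PV 1 := hS
  obtain ⟨M', instM', f, hT', hy, hlog⟩ := stub_KP fal hfal Ms (e φ) hφ'
  exact ⟨Ms, instMs, M', instM', e, f, hT', hpres, hy, hlog⟩

/-! ### 5. Stub probes (BC3): neither stub is cheaply the piece, the crux or the summit

Run in the planner folder (`bc/probes_birthMEP.lean`): `stub_toBB`-statement → MEP / → PneNP and
`stub_KP`-statement → MEP / → PneNP by `first | exact? | aesop` — all FAIL (recorded in bc/PROBES.md). -/

end Summit.PneNP.PneNP.Cruxes.Target.KrajicekSplit.BirthMEP
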